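import Literature.MathematicalPhysics.QuantumFieldTheory.Balaban1983to89.B7Prop4Flat

/-!
# Bałaban's averaging operations — B7 Proposition 4: THE k-UNIFORM INDUCTION (128)–(133) FROM THE ONE-STEP
# STATEMENT OF PROPOSITION 3, AT A GENERAL (LEVEL-DEPENDENT) BACKGROUND — the composition argument of pp. 37–38
# abstracted from the one-step maps `Q(Ū₀ʲ, ·)` of (127), with print's factors `(1 + O(1)L²α₀(level j))` carried as a
# product and every constant symbolic (`B7Prop4GeneralInduction`)

CITATION HEADER (lean-in-tree rule).  Audit cell `pub-balaban`, sub-cell `t4`, NE7c ROUND-2 crew seat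
`b2b-balaban-t4-ne7c-formalise-leaf-10` gen 8; owner table `t4/b2b-balaban-t4-ne7c-p1/LEAVES-NE7c-P1.md` v2.3 row
**S56** «[B7] PROPOSITION 4 (127)–(136) AT A GENERAL REGULAR BACKGROUND — k-UNIFORM» (WALL §3 item W-a: the Landau
correction `Cf` of [Balaban1985Variational] (44) IS the non-linear part `C_k` of Prop. 4, cited there as [4] Prop. 4);
this is file 1 of the row: the INDUCTION with the one-step Proposition 3 at a general background as a DISPLAYED per-level
hypothesis (row S55 supplies it); file 2 (`B7Prop4General`) applies it to S55's theorem BY NAME.  Source: T. Bałaban,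
*Averaging operations for lattice gauge theories*, Commun. Math. Phys. **98**, 17–51 (1985) [Balaban1985Averaging],
Sect. D pp. 36–39 = PDF pp. 20–23, renders `b2b-balaban-ref1/pages/1985-cmp98-averaging/1985-cmp98-averaging-p020-x2.png`
… `-p023-x2.png` READ AS IMAGES by this seat (2026-08-20).  Companion REUSED, not modified: `B7Prop4Flat` (b07 lineage
gen 17: the same induction at the FLAT background `U₀ = 1`, objects `logIter`/`linQIter`/`dbavg`/`linQ`, constants
`C1`/`c3`, `prop3_flat_global`, `two_mul_le_c3_of_small`) — §3 re-derives its bounds from the abstract theorem as a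
kernel cross-check.

THE PRINTED TEXT (quoted from the renders).  p. 37: «Now we will consider the k^{th} order average U̿₁^k. Its definition
implies that (1/i) log U̿₁^k as a function of (1/i) log U₁ is a composition of the functions Q(U₀, ·), Q(Ū₀, ·), …,
Q(Ū₀^{k−2}, ·), Q(Ū₀^{k−1}, ·). (127) We assume that U₀ satisfies the assumptions of Proposition 2 and U₁ = e^{iηA},
|A| < α₁. Then by this proposition the configurations Ū₀^j for j < k satisfy the assumptions of Proposition 3 for
V₀ = Ū₀^j if α₀L^{2j}η² + 2C₀(α₀L^{2j}η²)² ≦ 2α₀L^{2j}η² < α₀ ≦ c₃.»; «|Q(U₀, ηA) − LηQ(U₀)A| ≦ C₁(L|ηA|)² < C₁(α₁Lη)²»;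
«|(1/(Lη))Q(U₀, ηA)| < |Q(U₀)A| + C₁Lηα₁² < (1 + O(1)L²α₀η²)α₁ + C₁Lηα₁² < e^{O(1)L²η²α₀}α₁ + C₁Lηα₁². (128)»;
«so |Q(U₀, ηA)| < 2α₁Lη ≦ 2α₁ ≦ c₃ for α₁ ≦ ½c₃, and we can apply Proposition 3 to function Q(Ū₀, ·) calculated at
Q(U₀, ηA)»; «< e^{O(1)2α₀}(1 + 8C₁α₁)α₁ < 2α₁ for α₀, α₁ sufficiently small [e.g., O(1)α₀ ≦ 1/6, 8C₁α₁ ≦ 1/3]. (129)».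
p. 38: «Continuing these arguments, we arrive at the following inductive assumption for the composition Q_j(U₀, ηA) of
the first j functions (127) aad the composition Q_j(U₀) of their linear parts: |(1/(L^jη))Q_j(U₀, ηA) − Q_j(U₀)A| <
e^{O(1)(L^{2j}+…+L⁴+L²)η²α₀}·4C₁(L^j + … + L² + L)ηα₁². (130) This implies |(1/(L^jη))Q_j(U₀, ηA)| < … <
e^{O(1)2α₀}(1 + 8C₁α₁)α₁ < 2α₁, (131) and for α₁ ≦ ½c₃ we can apply Proposition 3 to the function Q(Ū₀^j, ·) calculated
at Q_j(U₀, ηA), and we get |Q(Ū₀^j, Q_j(U₀, ηA)) − L^{j+1}ηQ(Ū₀^j)(1/(L^jη))Q_j(U₀, ηA)| < C₁(L^{j+1}η)²|(1/(L^jη))Q_j(U₀,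
ηA)|² < 4C₁(L^{j+1}η)²α₁². (132) Applying (130) and denoting Q_{j+1}(U₀, ηA) = Q(Ū₀^j, Q_j(U₀, ηA)), Q_{j+1}(U₀) =
Q(Ū₀^j)Q_j(U₀), we have |(1/(L^{j+1}η))Q_{j+1}(U₀, ηA) − Q_{j+1}(U₀)A| < 4C₁L^{j+1}ηα₁² + e^{O(1)L²L^{2j}η²α₀}·
e^{O(1)(L^{2j}+…+L²)η²α₀}4C₁(L^j + … + L)ηα₁² < …»; «For j = k, we have |Q_k(U₀, ηA) − Q_k(U₀)A| <
e^{O(1)(1+L^{−2}+…+L^{−2(k−1)})α₀}·4C₁(1 + L^{−1} + … + L^{−(k−1)})α₁² < e^{O(1)2α₀}8C₁α₁² = C₂α₁². (133)»;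
Proposition 4: «There exist constants C₂, c₄ such that for α₀, α₁ ≦ c₄ the function Q_k(U₀, ηA, c) = (1/i) log(U̿₁^k)_c,
c ⊂ Ω^{(k)}, is an analytic function of the variables A_b, b ⊂ B^k(c₋)∪B^k(c₊). Further we have Q_k(U₀, ηA) =
Q_k(U₀)A + C_k(U₀, A), (134) and |C_k(U₀, A)| ≦ C₂|A|² < C₂α₁². (135)»; p. 39: «The constants C₂, c₄ are independent of
k, C₂ depends on d and c₄ depends on d and L.»  The one-step input, p. 36 (Proposition 3): «Q(V₀, A, c) = L(Q(V₀)A)_c +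
C(V₀, A, c). (122)», «|C(V₀, A, c)| ≦ C₁L²|A|² < C₁(Lα₁)². (123)», «|(Q(V₀)A)_c| ≦ |A| + O(1)L²α₀|A| < (1 + O(1)L²α₀)α₁
< e^{O(1)L²α₀}α₁. (126)».

THE TYPING (what is abstracted, and why it is faithful).  The proof of Prop. 4 on pp. 37–38 uses of the one-step maps
`Q(Ū₀ʲ, ·)` ONLY the three displayed facts (122), (123), (126) — at the level-`j` background, with the level-`j` value
`α₀(j) := 2α₀L^{2j}η²` of the regularity parameter (Prop. 2) inside the `O(1)L²α₀` of (126) — and composes them.  This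
file therefore takes, for each level `j < k`, an ARBITRARY one-step map `F j` («Q(Ū₀ʲ, ·)», read on the unit lattice as
in `B7Prop4Flat`) and an ARBITRARY additive linear part `Λ j` («L·Q(Ū₀ʲ)», un-normalised as in `B7Prop3Flat.linQ`) on
bond fields `σ → τ → 𝔸` (b07: `σ = Site d`, `τ = Fin d`), subject to (123) `‖F j A − Λ j A‖ ≤ C₁L²r²` for
`sup‖A‖ ≤ r ≤ c₃` and (126) `‖Λ j A‖ ≤ L(1 + κ_j)r` for `sup‖A‖ ≤ r`, with `κ_j ≥ 0` playing «O(1)L²α₀» at level `j`; the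
composites `X j` («Q_j(U₀, ηA)») and `Y j` («L^jη·Q_j(U₀)A») are given hypothesis-style by their recursions (so that
b07's `logIter_succ`/`linQIter_succ` and row S55's objects plug in by `rfl`); print's `e^{O(1)(L^{2j}+…+L²)η²α₀}` is
carried as the PRODUCT `P_j = ∏_{i<j}(1 + κ_i)` (`≤ exp Σκ_i`, §1) and bounded by a k-uniform `P`; the `i` and `η` are
absorbed as in `B7Prop4Flat` (`b` plays `ηα₁`, `L^j b` plays `L^jηα₁`).  PROVED (§2, `prop4_induction`): for `L ≥ 2`,
`C₁ ≥ 0`, `∏_{i<k}(1 + κ_i) ≤ P`, `P(1 + 8C₁L^kb) ≤ 2` («e^{O(1)2α₀}(1 + 8C₁α₁)α₁ < 2α₁», (131)) and `2L^jb ≤ c₃` for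
`j < k` («for α₁ ≦ ½c₃ we can apply Proposition 3»), every `j ≤ k` satisfies (130) in the form
`‖X j − Y j‖ ≤ 8C₁P_j(L^jb)²` (print's `(L^j+…+L)ηα₁²·L^jη ≤ 2(L^jηα₁)²` summed once for all — the step
`4C₁L²t² + 8C₁P_{j+1}Lt² ≤ 8C₁P_{j+1}(Lt)²` holds iff `L ≥ 2`, exactly b07's `hkey`), `‖Y j‖ ≤ P_j·L^jb` ((126) iterated)
and (131) `‖X j‖ ≤ 2L^jb`; at `j = k` this is (133)/(135) with `C₂ = 8C₁·P` («C₂ = e^{O(1)2α₀}8C₁»,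
`prop4_remainder_at_k`).  §3: at `κ ≡ 0`, `P = 1`, `F j := (1/i) log ∘ V̿₁[e^{·}]` and `Λ j := L·Q₀` of `B7Prop3Flat`
the abstract theorem RETURNS `B7Prop4Flat.prop4_flat_induction`'s bounds (ii)–(iii) (kernel cross-check
`flat_bounds_of_induction`; the two statements coincide token for token, `example`).  §4: the ANALYTICITY clause of
Prop. 4 («is an analytic function of the variables A_b») in the parametrised form of `B7Prop4Flat.prop4_flat_analyticAt`,
from a per-level analyticity-preservation hypothesis of `prop3_flat_analyticAt`'s shape (`prop4_induction_analyticAt`).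

ABSOLUTE-RULE LEDGER.  Nothing of the manuscript is cited as a fact: the one-step facts (122)/(123)/(126) at a general
background are HYPOTHESES (`hrem`, `hlin`, `hΛsub`; row S55 = `B7Prop3General*` proves them for the paper's objects,
b07's `prop3_flat_global`/`norm_linQ_le_of_bound`/`linQ_sub` prove them at `V₀ = 1`, §3), the regularity of the level
backgrounds (Prop. 2, `B7Prop2Explicit`) enters only through the numbers `κ_j`; what is PROVED is the composition
argument (128)–(133) itself, for every `k`, with symbolic constants.  0 sorry; 0 `def`.

DIVERGENCES from print (located).  (a) (130) is proved in the SUMMED form `8C₁P_j(L^jb)²` (print displays the partial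
sums `4C₁(L^j+…+L)ηα₁²` and sums them at (133)); (b) print's strict `<` are `≤`; (c) the smallness is displayed as the
two inequalities `P(1 + 8C₁L^kb) ≤ 2`, `2L^jb ≤ c₃ (j < k)` instead of «α₀, α₁ ≦ c₄» (print's bracket «e.g., O(1)α₀ ≦
1/6, 8C₁α₁ ≦ 1/3» is one way to meet the first); (d) fields on arbitrary index types `σ`, `τ` with GLOBAL sup bounds
(print: `|A| < α₁` on `Ω`), levels identified with one type (b07's `rescale` convention); (e) (134)/(136) — the NAME
`C_k` for the difference and its expansion in homogeneous polynomials — are not restated here (b07 §3 has them at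
`U₀ = 1`; the general-background version rides with file 2).  HONEST (cell): a reproduction of print's induction; rung
(B)+1 bookkeeping for NE7c's wall item W-a; NE7c NOT PROVED; spine PROVED 0/9; NOT infinite volume, NOT mass gap, NOT
Clay.  HONEST DEPENDENCY: continuum YM on T⁴ ⇐ BetaPertH ∧ nine spine estimates (0/9 proved); BetaPertH ⇐ (D1) ∧ (D4) ∧
CAP+tail; G-an2-4 gates asym, D1 and NE2/3/4.
-/

noncomputable section

open scoped BigOperators
open Finset

namespace Literature.MathematicalPhysics.QuantumFieldTheory.Balaban1983to89.B7Prop4GeneralInduction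

/-! ## §1 Arithmetic of the composition argument -/

section Arithmetic

/-- the product of the level factors `1 + κ_i` is at least `1`. [folklore] -/
private theorem one_le_prod_one_add (κ : ℕ → ℝ) (hκ : ∀ i, 0 ≤ κ i) :
    ∀ n : ℕ, 1 ≤ ∏ i ∈ range n, (1 + κ i)
  | 0 => by simp
  | n + 1 => by
    rw [prod_range_succ]
    have h1 := one_le_prod_one_add κ hκ n
    have h2 : 1 ≤ 1 + κ n := by linarith [hκ n]
    nlinarith

/-- the partial products are monotone in the number of levels. [folklore] -/
private theorem prod_one_add_mono (κ : ℕ → ℝ) (hκ : ∀ i, 0 ≤ κ i) {m n : ℕ} (h : m ≤ n) :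
    ∏ i ∈ range m, (1 + κ i) ≤ ∏ i ∈ range n, (1 + κ i) := by
  induction n, h using Nat.le_induction with
  | base => exact le_rfl
  | succ n _ ih =>
    rw [prod_range_succ]
    have h1 := one_le_prod_one_add κ hκ n
    have h2 : 1 ≤ 1 + κ n := by linarith [hκ n]
    nlinarith

/-- «e^{O(1)(L^{2j}+…+L²)η²α₀}» ((128)–(130)): print bounds each level factor `(1 + O(1)L²α₀η²…)` by an exponential and
multiplies — the product of the level factors is bounded by the exponential of the sum of the level increments,
`∏_{i<n}(1 + κ_i) ≤ exp(Σ_{i<n} κ_i)`. [cite: Balaban1985Averaging, (128)–(130) pp.37–38] -/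
theorem prod_one_add_le_exp_sum (κ : ℕ → ℝ) (hκ : ∀ i, 0 ≤ κ i) :
    ∀ n : ℕ, ∏ i ∈ range n, (1 + κ i) ≤ Real.exp (∑ i ∈ range n, κ i)
  | 0 => by simp
  | n + 1 => by
    rw [prod_range_succ, sum_range_succ, Real.exp_add]
    have h1 := prod_one_add_le_exp_sum κ hκ n
    have h2 : 1 + κ n ≤ Real.exp (κ n) := by
      have := Real.add_one_le_exp (κ n); linarith
    have h3 : 0 ≤ 1 + κ n := by linarith [hκ n]
    exact mul_le_mul h1 h2 h3 (Real.exp_pos _).le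

/-- the geometric sums of (131)/(133), «1 + L^{−2} + … + L^{−2(j−1)}» and «1 + L^{−1} + … + L^{−(k−1)}» (bounded in
print by the factor `2` of «e^{O(1)2α₀}» and of «8C₁ = 2·4C₁»), are `≤ 2` whenever the ratio is `≤ 1/2` (`L ≥ 2`).
[cite: Balaban1985Averaging, (131) p.38, (133) p.38] -/
theorem geom_sum_le_two {r : ℝ} (hr0 : 0 ≤ r) (hr : r ≤ 1 / 2) : ∀ n : ℕ, ∑ m ∈ range n, r ^ m ≤ 2
  | 0 => by simp
  | n + 1 => by
    have ih := geom_sum_le_two hr0 hr n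
    have hsplit : ∑ m ∈ range (n + 1), r ^ m = 1 + r * ∑ m ∈ range n, r ^ m := by
      rw [sum_range_succ', mul_sum]
      simp only [pow_succ, pow_zero]
      ring_nf
    rw [hsplit]
    nlinarith [sum_nonneg fun m (_ : m ∈ range n) => pow_nonneg hr0 m]

/-- THE KEY INEQUALITY OF THE INDUCTIVE STEP (p. 38, passage from (132) + (130) to (130)_{j+1}): with `t = L^jηα₁` and
the product factor `P' ≥ 1`, `4C₁L²t² + 8C₁P'·L·t² ≤ 8C₁P'·(Lt)²` — true iff `L ≥ 2` (this replaces print's re-summation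
of the geometric series; b07's `hkey` is the case `P' = 1`). [cite: Balaban1985Averaging, (132) p.38] -/
theorem step_key {L C₁ P' t : ℝ} (hL : 2 ≤ L) (hC : 0 ≤ C₁) (hP : 1 ≤ P') :
    C₁ * L ^ 2 * (2 * t) ^ 2 + L * (1 * P') * (8 * C₁ * t ^ 2) ≤ 8 * C₁ * P' * (L * t) ^ 2 := by
  have h1 : 0 ≤ C₁ * t ^ 2 := mul_nonneg hC (sq_nonneg t)
  have hLL : 0 ≤ L * (L - 1) := by nlinarith
  have hA : L * (L - 1) ≤ P' * (L * (L - 1)) := le_mul_of_one_le_left hLL hP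
  have h2 : 0 ≤ 8 * P' * L ^ 2 - 8 * P' * L - 4 * L ^ 2 := by nlinarith
  nlinarith [mul_nonneg h1 h2]

end Arithmetic

/-! ## §2 The induction (128)–(133) from the one-step statement (122)/(123)/(126) -/

section Induction

variable {σ τ 𝔸 : Type*} [SeminormedAddCommGroup 𝔸]

/-- **PROPOSITION 4's INDUCTION (128)–(133) AT A GENERAL BACKGROUND, k-UNIFORM — from the one-step statement.**
Data: per level `j < k` a one-step map `F j` («Q(Ū₀ʲ, ·)» of (127), read on the unit lattice) and its additive linear
part `Λ j` («L·Q(Ū₀ʲ)», un-normalised), with Proposition 3's displays at the level-`j` background as HYPOTHESES —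
`hrem` = (123) «|C(V₀, A, c)| ≦ C₁L²|A|²» for `sup‖A‖ ≤ r ≤ c₃`, `hlin` = (126) «|(Q(V₀)A)_c| ≦ (1 + O(1)L²α₀)|A|» with
`κ j ≥ 0` for the level's `O(1)L²α₀`; the composites `X j` («Q_j(U₀, ηA)») and `Y j` («L^jη·Q_j(U₀)A») by their
recursions «Q_{j+1}(U₀, ηA) = Q(Ū₀ʲ, Q_j(U₀, ηA)), Q_{j+1}(U₀) = Q(Ū₀ʲ)Q_j(U₀)»; an initial field with `sup‖B‖ ≤ b`
(«|A| < α₁», `b` = `ηα₁`).  Smallness: `∏_{i<k}(1 + κ_i) ≤ P` and `P(1 + 8C₁·L^kb) ≤ 2` («e^{O(1)2α₀}(1 + 8C₁α₁)α₁ <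
2α₁», (131)), `2L^jb ≤ c₃` for `j < k` («for α₁ ≦ ½c₃ we can apply Proposition 3 to the function Q(Ū₀ʲ, ·) calculated
at Q_j(U₀, ηA)»), `L ≥ 2`.  CONCLUSION for every `j ≤ k`: (130) `‖X j − Y j‖ ≤ 8C₁·∏_{i<j}(1 + κ_i)·(L^jb)²`;
(126) iterated `‖Y j‖ ≤ ∏_{i<j}(1 + κ_i)·L^jb`; (131) = (161) `‖X j‖ ≤ 2L^jb`.  Every constant symbolic; uniform in
`k`. [cite: Balaban1985Averaging, (128)–(133) pp.37–38, (161) p.42] -/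
theorem prop4_induction {L C₁ c₃ b P : ℝ} (hL : 2 ≤ L) (hC₁ : 0 ≤ C₁) {k : ℕ}
    (κ : ℕ → ℝ) (hκ : ∀ j, 0 ≤ κ j)
    (F Λ : ℕ → (σ → τ → 𝔸) → (σ → τ → 𝔸))
    (hΛsub : ∀ j < k, ∀ A A' : σ → τ → 𝔸, Λ j (A - A') = Λ j A - Λ j A')
    (hrem : ∀ j < k, ∀ (A : σ → τ → 𝔸) (r : ℝ), 0 ≤ r → r ≤ c₃ → (∀ x y, ‖A x y‖ ≤ r) →
      ∀ x y, ‖F j A x y - Λ j A x y‖ ≤ C₁ * L ^ 2 * r ^ 2)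
    (hlin : ∀ j < k, ∀ (A : σ → τ → 𝔸) (r : ℝ), 0 ≤ r → (∀ x y, ‖A x y‖ ≤ r) →
      ∀ x y, ‖Λ j A x y‖ ≤ L * (1 + κ j) * r)
    (B : σ → τ → 𝔸) (hb : 0 ≤ b) (hB : ∀ x y, ‖B x y‖ ≤ b)
    (X Y : ℕ → σ → τ → 𝔸) (hX0 : X 0 = B) (hXs : ∀ j < k, X (j + 1) = F j (X j))
    (hY0 : Y 0 = B) (hYs : ∀ j < k, Y (j + 1) = Λ j (Y j))
    (hP : ∏ i ∈ range k, (1 + κ i) ≤ P) (hsmall : P * (1 + 8 * C₁ * (L ^ k * b)) ≤ 2)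
    (hc₃ : ∀ j < k, 2 * (L ^ j * b) ≤ c₃) :
    ∀ j ≤ k,
      (∀ x y, ‖X j x y - Y j x y‖ ≤ 8 * C₁ * (∏ i ∈ range j, (1 + κ i)) * (L ^ j * b) ^ 2) ∧
      (∀ x y, ‖Y j x y‖ ≤ (∏ i ∈ range j, (1 + κ i)) * (L ^ j * b)) ∧
      (∀ x y, ‖X j x y‖ ≤ 2 * (L ^ j * b)) := by
  have hL1 : (1 : ℝ) ≤ L := by linarith
  have hL0 : (0 : ℝ) ≤ L := by linarith
  have ht_mono : ∀ {j : ℕ}, j ≤ k → L ^ j * b ≤ L ^ k * b := fun hj =>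
    mul_le_mul_of_nonneg_right (pow_le_pow_right₀ hL1 hj) hb
  have hP1 : ∀ j, 1 ≤ ∏ i ∈ range j, (1 + κ i) := one_le_prod_one_add κ hκ
  intro j
  induction j with
  | zero =>
    intro _
    refine ⟨fun x y => ?_, fun x y => ?_, fun x y => ?_⟩
    · rw [hX0, hY0, sub_self, norm_zero]
      exact mul_nonneg (mul_nonneg (mul_nonneg (by norm_num) hC₁) (by simp)) (sq_nonneg _)
    · rw [hY0, prod_range_zero, pow_zero, one_mul, one_mul]; exact hB x y
    · rw [hX0, pow_zero, one_mul]; linarith [hB x y, norm_nonneg (B x y)]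
  | succ j ih =>
    intro hjk
    have hj : j < k := Nat.lt_of_succ_le hjk
    obtain ⟨hE, hYb, hT⟩ := ih hj.le
    set t : ℝ := L ^ j * b with ht
    set Pj : ℝ := ∏ i ∈ range j, (1 + κ i) with hPj
    have ht0 : 0 ≤ t := by positivity
    have hPj1 : 1 ≤ Pj := hP1 j
    have hκj := hκ j
    have hPsucc : ∏ i ∈ range (j + 1), (1 + κ i) = Pj * (1 + κ j) := prod_range_succ _ _
    have hP'1 : 1 ≤ Pj * (1 + κ j) := by nlinarith
    have htL : L ^ (j + 1) * b = L * t := by rw [ht, pow_succ]; ring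
    -- Prop. 3 applies at level j: sup‖X j‖ ≤ 2t ≤ c₃
    have h2t : 2 * t ≤ c₃ := hc₃ j hj
    have hR : ∀ x y, ‖F j (X j) x y - Λ j (X j) x y‖ ≤ C₁ * L ^ 2 * (2 * t) ^ 2 :=
      hrem j hj (X j) (2 * t) (by positivity) h2t hT
    -- the linear part on the error field X j − Y j
    have hLE : ∀ x y, ‖Λ j (X j - Y j) x y‖ ≤ L * (1 + κ j) * (8 * C₁ * Pj * t ^ 2) :=
      hlin j hj (X j - Y j) _ (by positivity) fun x y => by rw [Pi.sub_apply, Pi.sub_apply]; exact hE x y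
    -- (130) at j + 1
    have hE' : ∀ x y, ‖X (j + 1) x y - Y (j + 1) x y‖ ≤ 8 * C₁ * (Pj * (1 + κ j)) * (L * t) ^ 2 := by
      intro x y
      rw [hXs j hj, hYs j hj]
      have hsplit : F j (X j) x y - Λ j (Y j) x y =
          (F j (X j) x y - Λ j (X j) x y) + Λ j (X j - Y j) x y := by
        rw [hΛsub j hj, Pi.sub_apply, Pi.sub_apply]; abel
      rw [hsplit]
      calc ‖(F j (X j) x y - Λ j (X j) x y) + Λ j (X j - Y j) x y‖
          ≤ ‖F j (X j) x y - Λ j (X j) x y‖ + ‖Λ j (X j - Y j) x y‖ := norm_add_le _ _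
        _ ≤ C₁ * L ^ 2 * (2 * t) ^ 2 + L * (1 + κ j) * (8 * C₁ * Pj * t ^ 2) := add_le_add (hR x y) (hLE x y)
        _ = C₁ * L ^ 2 * (2 * t) ^ 2 + L * (1 * (Pj * (1 + κ j))) * (8 * C₁ * t ^ 2) := by ring
        _ ≤ 8 * C₁ * (Pj * (1 + κ j)) * (L * t) ^ 2 := step_key hL hC₁ hP'1
    -- (126) iterated at j + 1
    have hYb' : ∀ x y, ‖Y (j + 1) x y‖ ≤ Pj * (1 + κ j) * (L * t) := by
      intro x y
      rw [hYs j hj]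
      calc ‖Λ j (Y j) x y‖ ≤ L * (1 + κ j) * (Pj * t) := hlin j hj (Y j) _ (by positivity) hYb x y
        _ = Pj * (1 + κ j) * (L * t) := by ring
    refine ⟨?_, ?_, ?_⟩
    · rw [hPsucc, htL]; exact hE'
    · rw [hPsucc, htL]; exact hYb'
    · -- (131) at j + 1: ‖X‖ ≤ ‖Y‖ + ‖X − Y‖ ≤ P'(Lt)(1 + 8C₁(Lt)) ≤ (Lt)·P(1 + 8C₁L^kb) ≤ 2(Lt)
      intro x y
      rw [htL]
      have hP'le : Pj * (1 + κ j) ≤ P := by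
        rw [← hPsucc]; exact (prod_one_add_mono κ hκ hjk).trans hP
      have hLt_le : L * t ≤ L ^ k * b := by rw [← htL]; exact ht_mono hjk
      have hsum : ‖X (j + 1) x y‖ ≤ Pj * (1 + κ j) * (L * t) + 8 * C₁ * (Pj * (1 + κ j)) * (L * t) ^ 2 := by
        have h := norm_add_le (Y (j + 1) x y) (X (j + 1) x y - Y (j + 1) x y)
        rw [add_sub_cancel] at h
        exact h.trans (add_le_add (hYb' x y) (hE' x y))
      have hLt0 : 0 ≤ L * t := by positivity
      have hfac : Pj * (1 + κ j) * (L * t) + 8 * C₁ * (Pj * (1 + κ j)) * (L * t) ^ 2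
          = (L * t) * (Pj * (1 + κ j) * (1 + 8 * C₁ * (L * t))) := by ring
      have hbr : Pj * (1 + κ j) * (1 + 8 * C₁ * (L * t)) ≤ 2 := by
        have h1 : 1 + 8 * C₁ * (L * t) ≤ 1 + 8 * C₁ * (L ^ k * b) := by nlinarith
        have h2 : 0 ≤ 1 + 8 * C₁ * (L * t) := by positivity
        calc Pj * (1 + κ j) * (1 + 8 * C₁ * (L * t)) ≤ P * (1 + 8 * C₁ * (L ^ k * b)) :=
              mul_le_mul hP'le h1 h2 (by linarith)
          _ ≤ 2 := hsmall
      rw [hfac] at hsum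
      calc ‖X (j + 1) x y‖ ≤ (L * t) * (Pj * (1 + κ j) * (1 + 8 * C₁ * (L * t))) := hsum
        _ ≤ (L * t) * 2 := mul_le_mul_of_nonneg_left hbr hLt0
        _ = 2 * (L * t) := by ring

/-- **(133)/(135) — THE REMAINDER AT THE LAST LEVEL WITH THE k-UNIFORM CONSTANT**: under the hypotheses of
`prop4_induction`, `‖X k − Y k‖ ≤ 8C₁·P·(L^kb)²` — print's «|Q_k(U₀, ηA) − Q_k(U₀)A| < e^{O(1)2α₀}8C₁α₁² = C₂α₁²»
with `C₂ = 8C₁·P`, `P` the k-uniform bound of the level products. [cite: Balaban1985Averaging, (133) p.38, (135) p.38] -/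
theorem prop4_remainder_at_k {L C₁ c₃ b P : ℝ} (hL : 2 ≤ L) (hC₁ : 0 ≤ C₁) {k : ℕ}
    (κ : ℕ → ℝ) (hκ : ∀ j, 0 ≤ κ j)
    (F Λ : ℕ → (σ → τ → 𝔸) → (σ → τ → 𝔸))
    (hΛsub : ∀ j < k, ∀ A A' : σ → τ → 𝔸, Λ j (A - A') = Λ j A - Λ j A')
    (hrem : ∀ j < k, ∀ (A : σ → τ → 𝔸) (r : ℝ), 0 ≤ r → r ≤ c₃ → (∀ x y, ‖A x y‖ ≤ r) →
      ∀ x y, ‖F j A x y - Λ j A x y‖ ≤ C₁ * L ^ 2 * r ^ 2)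
    (hlin : ∀ j < k, ∀ (A : σ → τ → 𝔸) (r : ℝ), 0 ≤ r → (∀ x y, ‖A x y‖ ≤ r) →
      ∀ x y, ‖Λ j A x y‖ ≤ L * (1 + κ j) * r)
    (B : σ → τ → 𝔸) (hb : 0 ≤ b) (hB : ∀ x y, ‖B x y‖ ≤ b)
    (X Y : ℕ → σ → τ → 𝔸) (hX0 : X 0 = B) (hXs : ∀ j < k, X (j + 1) = F j (X j))
    (hY0 : Y 0 = B) (hYs : ∀ j < k, Y (j + 1) = Λ j (Y j))
    (hP : ∏ i ∈ range k, (1 + κ i) ≤ P) (hsmall : P * (1 + 8 * C₁ * (L ^ k * b)) ≤ 2)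
    (hc₃ : ∀ j < k, 2 * (L ^ j * b) ≤ c₃) :
    ∀ x y, ‖X k x y - Y k x y‖ ≤ 8 * C₁ * P * (L ^ k * b) ^ 2 := by
  intro x y
  have h := (prop4_induction hL hC₁ κ hκ F Λ hΛsub hrem hlin B hb hB X Y hX0 hXs hY0 hYs hP hsmall hc₃ k le_rfl).1
    x y
  refine h.trans (mul_le_mul_of_nonneg_right (mul_le_mul_of_nonneg_left hP ?_) (sq_nonneg _))
  exact mul_nonneg (by norm_num) hC₁

end Induction

/-! ## §3 Kernel cross-check: the flat background `U₀ = 1` (b07) is the instance `κ ≡ 0`, `P = 1` -/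

section Flat

open B7Prop1Explicit B7Prop3Flat B7Prop4Flat MatrixLog

variable {d : ℕ} {𝔸 : Type*} [NormedRing 𝔸] [NormedAlgebra ℂ 𝔸] [CompleteSpace 𝔸]

/-- **`B7Prop4Flat.prop4_flat_induction`'s bounds (ii)–(iii) FROM THE ABSTRACT INDUCTION**: at `U₀ = 1` take
`F j A (z, κ) := (1/i) log V̿₁(⟨Lz, Lz + Le_κ⟩)[e^{A}]` and `Λ j A (z, κ) := L·(Q₀A)` there (the same map at every
level), `κ ≡ 0`, `P = 1`; (123) is `prop3_flat_global`, (126) is `norm_linQ_le_of_bound`, additivity is `linQ_sub`, and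
«α₁ ≦ ½c₃» at the levels `j < k` is `two_mul_le_c3_of_small`. [cite: Balaban1985Averaging, (128)–(132) pp.37–38] -/
theorem flat_bounds_of_induction (L : ℕ) (hL : 2 ≤ L) (B : B7Prop1Explicit.Site d → Fin d → 𝔸) {b : ℝ} (hb : 0 ≤ b)
    (hB : ∀ x κ, ‖B x κ‖ ≤ b) (k : ℕ) (hk : 8 * C1 d * ((L : ℝ) ^ k * b) ≤ 1) :
    ∀ j ≤ k, (∀ z κ, ‖logIter L B j z κ - linQIter L B j z κ‖ ≤ 8 * C1 d * ((L : ℝ) ^ j * b) ^ 2) ∧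
      (∀ z κ, ‖logIter L B j z κ‖ ≤ 2 * ((L : ℝ) ^ j * b)) := by
  have hL1 : 1 ≤ L := le_trans (by norm_num) hL
  have hLr : (2 : ℝ) ≤ L := by exact_mod_cast hL
  have hC1 := (C1_pos d).le
  have h := prop4_induction (σ := B7Prop1Explicit.Site d) (τ := Fin d) (𝔸 := 𝔸) (c₃ := c3 d L) (P := 1) hLr hC1 (k := k)
    (fun _ => (0 : ℝ)) (fun _ => le_rfl)
    (fun _ A z κ => mlog ((dbavg L (expCfg A) ((L : ℤ) • z) κ : 𝔸ˣ) : 𝔸))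
    (fun _ A z κ => linQ L A ((L : ℤ) • z) κ)
    (fun _ _ A A' => funext fun z => funext fun κ => linQ_sub L A A' _ κ)
    (fun _ _ A r hr hrc hA z κ => (prop3_flat_global A hr hA L hL1 hrc ((L : ℤ) • z) κ).1)
    (fun _ _ A r hr hA z κ => by
      rw [add_zero, mul_one]; exact norm_linQ_le_of_bound A hr hA L hL1 _ κ)
    B hb hB (logIter L B) (linQIter L B) rfl (fun j _ => funext fun z => funext fun κ => logIter_succ L B j z κ)
    rfl (fun j _ => funext fun z => funext fun κ => linQIter_succ L B j z κ)
    (by simp) (by rw [one_mul]; linarith)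
    (fun j hj => by
      refine two_mul_le_c3_of_small L hL1 (by positivity) ?_
      have hmono : (L : ℝ) * ((L : ℝ) ^ j * b) ≤ (L : ℝ) ^ k * b := by
        rw [← mul_assoc, ← pow_succ']
        exact mul_le_mul_of_nonneg_right (pow_le_pow_right₀ (by exact_mod_cast hL1) hj) hb
      exact (mul_le_mul_of_nonneg_left hmono (by positivity)).trans hk)
  intro j hj
  obtain ⟨h1, -, h3⟩ := h j hj
  refine ⟨fun z κ => ?_, h3⟩
  have := h1 z κ
  simpa only [prod_const_one, mul_one, add_zero] using this

/-- the two statements COINCIDE: b07's own `prop4_flat_induction` yields the same two clauses token for token.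
[cite: Balaban1985Averaging, (130)–(131) p.38] -/
example (L : ℕ) (hL : 2 ≤ L) (B : B7Prop1Explicit.Site d → Fin d → 𝔸) {b : ℝ} (hb : 0 ≤ b)
    (hB : ∀ x κ, ‖B x κ‖ ≤ b) (k : ℕ) (hk : 8 * C1 d * ((L : ℝ) ^ k * b) ≤ 1) :
    ∀ j ≤ k, (∀ z κ, ‖logIter L B j z κ - linQIter L B j z κ‖ ≤ 8 * C1 d * ((L : ℝ) ^ j * b) ^ 2) ∧
      (∀ z κ, ‖logIter L B j z κ‖ ≤ 2 * ((L : ℝ) ^ j * b)) := fun j hj =>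
  ⟨(prop4_flat_induction L hL B hb hB k hk j hj).2.1, (prop4_flat_induction L hL B hb hB k hk j hj).2.2⟩

end Flat

/-! ## §4 The analyticity clause by composition ((127): «a composition of the functions Q(U₀, ·), …, Q(Ū₀^{k−1}, ·)») -/

section Analytic

variable {σ τ 𝔸 E : Type*} [NormedAddCommGroup 𝔸] [NormedSpace ℂ 𝔸] [NormedAddCommGroup E] [NormedSpace ℂ E]

/-- **PROPOSITION 4's ANALYTICITY CLAUSE FROM THE ONE-STEP ONE** (parametrised form of
`B7Prop4Flat.prop4_flat_analyticAt`, general background): suppose each one-step map preserves bondwise analyticity in a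
parameter `t ∈ E` at fields of sup norm `≤ r ≤ c₃` (hypothesis `hFan`, the shape of `B7Prop3Flat.prop3_flat_analyticAt`
with a global bound — Proposition 3's «is an analytic function of A» at the level background), and the bound hypotheses
of `prop4_induction` hold at `t₀`.  Then every composite `t ↦ X j t` («Q_j(U₀, ηB(t))»), `j ≤ k`, is bondwise analytic at
`t₀` — the domain being supplied by (131): `sup‖X j t₀‖ ≤ 2L^jb ≤ c₃`. [cite: Balaban1985Averaging, Prop. 4 p.38, (127) p.37, (131) p.38] -/
theorem prop4_induction_analyticAt {L C₁ c₃ b P : ℝ} (hL : 2 ≤ L) (hC₁ : 0 ≤ C₁) {k : ℕ}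
    (κ : ℕ → ℝ) (hκ : ∀ j, 0 ≤ κ j)
    (F Λ : ℕ → (σ → τ → 𝔸) → (σ → τ → 𝔸))
    (hΛsub : ∀ j < k, ∀ A A' : σ → τ → 𝔸, Λ j (A - A') = Λ j A - Λ j A')
    (hrem : ∀ j < k, ∀ (A : σ → τ → 𝔸) (r : ℝ), 0 ≤ r → r ≤ c₃ → (∀ x y, ‖A x y‖ ≤ r) →
      ∀ x y, ‖F j A x y - Λ j A x y‖ ≤ C₁ * L ^ 2 * r ^ 2)
    (hlin : ∀ j < k, ∀ (A : σ → τ → 𝔸) (r : ℝ), 0 ≤ r → (∀ x y, ‖A x y‖ ≤ r) →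
      ∀ x y, ‖Λ j A x y‖ ≤ L * (1 + κ j) * r)
    (hFan : ∀ j < k, ∀ (A : E → σ → τ → 𝔸) (t₀ : E) (r : ℝ), 0 ≤ r → r ≤ c₃ →
      (∀ x y, ‖A t₀ x y‖ ≤ r) → (∀ x y, AnalyticAt ℂ (fun t => A t x y) t₀) →
      ∀ x y, AnalyticAt ℂ (fun t => F j (A t) x y) t₀)
    (Bt : E → σ → τ → 𝔸) (t₀ : E) (hBan : ∀ x y, AnalyticAt ℂ (fun t => Bt t x y) t₀)
    (hb : 0 ≤ b) (hB : ∀ x y, ‖Bt t₀ x y‖ ≤ b)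
    (Xt : ℕ → E → σ → τ → 𝔸) (hX0 : ∀ t, Xt 0 t = Bt t) (hXs : ∀ j < k, ∀ t, Xt (j + 1) t = F j (Xt j t))
    (hP : ∏ i ∈ range k, (1 + κ i) ≤ P) (hsmall : P * (1 + 8 * C₁ * (L ^ k * b)) ≤ 2)
    (hc₃ : ∀ j < k, 2 * (L ^ j * b) ≤ c₃) :
    ∀ j ≤ k, ∀ x y, AnalyticAt ℂ (fun t => Xt j t x y) t₀ := by
  -- the bounds (131) at t₀, for the sequence j ↦ Xt j t₀ (its linear companion is irrelevant: take Y from Λ)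
  let Y : ℕ → σ → τ → 𝔸 := fun j => Nat.rec (Bt t₀) (fun i A => Λ i A) j
  have hY0 : Y 0 = Bt t₀ := rfl
  have hYs : ∀ j < k, Y (j + 1) = Λ j (Y j) := fun j _ => rfl
  have hbd := prop4_induction hL hC₁ κ hκ F Λ hΛsub hrem hlin (Bt t₀) hb hB (fun j => Xt j t₀) Y (hX0 t₀)
    (fun j hj => hXs j hj t₀) hY0 hYs hP hsmall hc₃
  intro j
  induction j with
  | zero => intro _ x y; simp only [hX0]; exact hBan x y
  | succ j ih =>
    intro hjk x y
    have hj : j < k := Nat.lt_of_succ_le hjk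
    have hA : ∀ x y, ‖Xt j t₀ x y‖ ≤ 2 * (L ^ j * b) := (hbd j hj.le).2.2
    have h := hFan j hj (Xt j) t₀ (2 * (L ^ j * b)) (by positivity) (hc₃ j hj) hA (ih hj.le) x y
    have hfun : (fun t => Xt (j + 1) t x y) = fun t => F j (Xt j t) x y := funext fun t => by rw [hXs j hj t]
    rw [hfun]; exact h

end Analytic

end Literature.MathematicalPhysics.QuantumFieldTheory.Balaban1983to89.B7Prop4GeneralInduction

end
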